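import Summits.KontsevichZagierPeriods.KontsevichZagierPeriods.Theorems.HurwitzMicroSectorsNormalFormPrincipleM2CycloKit
import Summits.KontsevichZagierPeriods.KontsevichZagierPeriods.Theorems.HurwitzMicroSectorsNormalFormPrincipleM2LogMonomialInvSubZetaBandRat
import Summits.KontsevichZagierPeriods.KontsevichZagierPeriods.Theorems.HurwitzMicroSectorsNormalFormPrincipleM2CycloPeel
import Summits.KontsevichZagierPeriods.KontsevichZagierPeriods.Theorems.HurwitzMicroSectorsNormalFormPrincipleM2CycloBase
import Summits.KontsevichZagierPeriods.KontsevichZagierPeriods.Theorems.HurwitzMicroSectorsNormalFormPrincipleLevelOne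

/-!
# `NormalFormPrinciple` (stmt-KontsevichZagierPeriods-3869), line `SketchIdeator1` — leaf `stub_boxRigidity`:
# the CYCLOTOMIC LOG LAYER, I: reduction of every cyclotomic log monomial to a level-one box

Composition (lead seat c8) of the four registered wave-4 stubs (`cyclo_kit`, `logMonomialInv_sub_zetaBand_rat`,
`cyclo_peel`, `cyclo_base`, all landed) with seat c7's level-one layer. The layer generalising P3
(`FiveZetaTwoOffProduct`): the unfolded log monomials
`M(c/x, F/F') = [{0 < x < 1, 1 ≤ s ≤ F(x)/F'(x)}, (c/x)/s]` (`c ∈ ℚ`; value `∫₀¹ (c/x) log(F/F') dx`)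
whose edges are quotients `F/F'` (`F' ≤ F` on `(0,1)`) of finite products
`F(n,a,b)(x) = ∏_{d<n} G_{d+1}(x)^{a d} · H_{d+1}(x)^{b d}` of the cyclotomic-type factors
`G_{d+1} = 1 + x + ⋯ + x^d` and `H_{d+1} = 1/(1 − x^{d+1})` — Mahler-measure-type logarithmic periods with
values in `ℚ·ζ(2)` (`∫₀¹ (c/x) log G_{d+1} = cζ(2)(1 − 1/(d+1))`, `∫₀¹ (c/x) log H_{d+1} = cζ(2)/(d+1)`).

* `cycloMonomial_prod_reduce` / `cycloMonomial_reduce`: by rules (1a), (1b), (2) only — product rule on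
  unfolded monomials (peeling one factor at a time, `cyclo_peel`), base dilations `u = x^{d+1}` and the
  ζ(2) block with rational weight (`cyclo_base`, `logMonomial_dilate`, `logMonomialInv_sub_zetaBand_rat`) —
  every such monomial is congruent to ONE level-one box `[(0,1)², cρ/(1 − xy)]`, `ρ ∈ ℚ` explicit;
* `cyclo_mem_relations_of_eval_eq_zero_of_mem_closure`: **Conjecture 1 of Kontsevich–Zagier, kernel form,
  on the subgroup generated by all cyclotomic log monomials, the level-one boxes `[(0,1)², P/(1−xy)]` and
  the polynomial boxes `[(0,1)ᵐ, p]`**, unconditionally (reduction to c7's normal form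
  `[(0,1)², β/(1−xy)] + [pt, q]`; rigidity `π² ∉ ℚ`);
* two-representation corollaries (monomial vs monomial, vs level-one box, vs polynomial box / rational point).
References: M. Kontsevich, D. Zagier, *Periods* (2001), §1.1 (logarithmic integrands, Mahler measures),
§1.2 (rules (1), (2), Conjecture 1). No definitions are introduced.
-/

noncomputable section

open MeasureTheory Set
open Literature.NumberTheory.Transcendental Literature.NumberTheory.Transcendental.KZ
open Literature.ModelTheory.ExponentialFields (IsSemialgebraic)

namespace Summit.KontsevichZagierPeriods.HurwitzMicroSectors.NormalFormPrinciple.PiBox.M2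

/-! ## The composition (lead): reduction of every cyclotomic log monomial to a level-one box -/

open Summit.KontsevichZagierPeriods.HurwitzMicroSectors.NormalFormPrinciple.PiBox.LevelOne
  (exists_zetaTwoRep zetaTwoRep_add_mem_relations zetaTwoRep_congr_mem_relations
    zetaTwoRep_zero_mem_relations mem_relations_of_eval_eq_zero_of_mem_closure)

/-- The weight `c/x` (`c ∈ ℚ`) is `ℚ`-semialgebraic on `(0,1)`. [folklore] -/
theorem isSemialgebraicFunOn_ratCast_div (c : ℚ) :
    IsSemialgebraicFunOn ℚ {y : Fin 1 → ℝ | 0 < y 0 ∧ y 0 < 1}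
      (fun y => (fun x : ℝ => (c : ℝ) / x) (y 0)) := by
  refine (isSemialgebraicFunOn_aeval_div_aeval isSemialgebraic_unitInterval_fin_one
    (MvPolynomial.C c) (MvPolynomial.X 0) fun y hy => ?_).congr fun y _ => by simp
  simpa using hy.1.ne'

/-- **Existence of the cyclotomic log monomial** `M(c/x, F(n,a,b))` (from `cyclo_kit` and
`exists_logMonomialRep`). [cite: KontsevichZagier2001, §1.1] -/
theorem exists_cycloMonomialRep (c : ℚ) (n : ℕ) (a b : ℕ → ℕ) :
    ∃ R : IntegralRep 2,
      R.domain = KZlog.band {y : Fin 1 → ℝ | 0 < y 0 ∧ y 0 < 1} (fun _ => (1:ℝ))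
        (fun y => ∏ d ∈ Finset.range n,
          (∑ i ∈ Finset.range (d + 1), y 0 ^ i) ^ (a d) * (1 / (1 - y 0 ^ (d + 1))) ^ (b d)) ∧
      R.integrand = fun z => ((c : ℝ) / z 0) / z 1 := by
  obtain ⟨hsa, h1, hint⟩ := cyclo_kit n a b
  obtain ⟨R, hRd, hRi⟩ := exists_logMonomialRep _ _ (isSemialgebraicFunOn_ratCast_div c) hsa h1 (hint c)
  exact ⟨R, hRd, hRi⟩

/-- Peeling bookkeeping: the edge `F(n,a,b)·G_{n+1}^i·H_{n+1}^j` is the edge `F(n+1, a[n↦i], b[n↦j])`.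
[folklore] -/
theorem cycloEdge_update (n : ℕ) (a b : ℕ → ℕ) (i j : ℕ) (x : ℝ) :
    (∏ d ∈ Finset.range n,
        (∑ k ∈ Finset.range (d + 1), x ^ k) ^ (a d) * (1 / (1 - x ^ (d + 1))) ^ (b d)) *
      (∑ k ∈ Finset.range (n + 1), x ^ k) ^ i * (1 / (1 - x ^ (n + 1))) ^ j =
    ∏ d ∈ Finset.range (n + 1),
        (∑ k ∈ Finset.range (d + 1), x ^ k) ^ (Function.update a n i d) *
          (1 / (1 - x ^ (d + 1))) ^ (Function.update b n j d) := by
  rw [Finset.prod_range_succ, Function.update_self, Function.update_self, mul_assoc]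
  congr 1
  exact Finset.prod_congr rfl fun d hd => by
    rw [Function.update_of_ne (Finset.mem_range.1 hd).ne, Function.update_of_ne (Finset.mem_range.1 hd).ne]

/-- **Reduction of the pure-product cyclotomic log monomials**, inner induction: for fixed `n, a, b`,
`M(c/x, F(n,a,b)·G_{n+1}^i·H_{n+1}^j) ≡ [(0,1)², c(ρ + i(1 − 1/(n+1)) + j/(n+1))/(1−xy)]` whenever
`M(c/x, F(n,a,b)) ≡ [(0,1)², cρ/(1−xy)]`. [cite: KontsevichZagier2001, §1.2] -/
theorem cycloMonomial_peel_reduce (c ρ : ℚ) (n : ℕ) (a b : ℕ → ℕ)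
    (IH : ∀ (R B : IntegralRep 2),
      R.domain = KZlog.band {y : Fin 1 → ℝ | 0 < y 0 ∧ y 0 < 1} (fun _ => (1:ℝ))
        (fun y => ∏ d ∈ Finset.range n,
          (∑ i ∈ Finset.range (d + 1), y 0 ^ i) ^ (a d) * (1 / (1 - y 0 ^ (d + 1))) ^ (b d)) →
      EqOn R.integrand (fun z => ((c : ℝ) / z 0) / z 1) R.domain →
      B.domain = {x | ∀ i, x i ∈ Set.Ioo (0:ℝ) 1} →
      EqOn B.integrand (fun x => ((c * ρ : ℚ) : ℝ) / (1 - x 0 * x 1)) B.domain →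
      of R - of B ∈ relations) :
    ∀ (i j : ℕ) (R B : IntegralRep 2),
      R.domain = KZlog.band {y : Fin 1 → ℝ | 0 < y 0 ∧ y 0 < 1} (fun _ => (1:ℝ))
        (fun y => (∏ d ∈ Finset.range n,
          (∑ k ∈ Finset.range (d + 1), y 0 ^ k) ^ (a d) * (1 / (1 - y 0 ^ (d + 1))) ^ (b d)) *
            (∑ k ∈ Finset.range (n + 1), y 0 ^ k) ^ i * (1 / (1 - y 0 ^ (n + 1))) ^ j) →
      EqOn R.integrand (fun z => ((c : ℝ) / z 0) / z 1) R.domain →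
      B.domain = {x | ∀ i, x i ∈ Set.Ioo (0:ℝ) 1} →
      EqOn B.integrand (fun x => ((c * (ρ + i * (1 - 1 / (n + 1)) + j / (n + 1)) : ℚ) : ℝ) /
        (1 - x 0 * x 1)) B.domain →
      of R - of B ∈ relations := by
  have hG := isSemialgebraic_unitInterval_fin_one
  -- the edge with `i, j` extra factors is a cyclotomic edge at level `n + 1`
  have hedge : ∀ (i j : ℕ), ∀ y ∈ {y : Fin 1 → ℝ | 0 < y 0 ∧ y 0 < 1},
      (∏ d ∈ Finset.range n,
          (∑ k ∈ Finset.range (d + 1), y 0 ^ k) ^ (a d) * (1 / (1 - y 0 ^ (d + 1))) ^ (b d)) *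
            (∑ k ∈ Finset.range (n + 1), y 0 ^ k) ^ i * (1 / (1 - y 0 ^ (n + 1))) ^ j =
      ∏ d ∈ Finset.range (n + 1),
        (∑ k ∈ Finset.range (d + 1), y 0 ^ k) ^ (Function.update a n i d) *
          (1 / (1 - y 0 ^ (d + 1))) ^ (Function.update b n j d) :=
    fun i j y _ => cycloEdge_update n a b i j (y 0)
  have hsa : ∀ (i j : ℕ), IsSemialgebraicFunOn ℚ {y : Fin 1 → ℝ | 0 < y 0 ∧ y 0 < 1}
      (fun y => (fun x : ℝ => (∏ d ∈ Finset.range n,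
          (∑ k ∈ Finset.range (d + 1), x ^ k) ^ (a d) * (1 / (1 - x ^ (d + 1))) ^ (b d)) *
            (∑ k ∈ Finset.range (n + 1), x ^ k) ^ i * (1 / (1 - x ^ (n + 1))) ^ j) (y 0)) :=
    fun i j => (cyclo_kit (n + 1) (Function.update a n i) (Function.update b n j)).1.congr
      fun y hy => (hedge i j y hy).symm
  have h1 : ∀ (i j : ℕ), ∀ x ∈ Set.Ioo (0:ℝ) 1, 1 ≤ (fun x : ℝ => (∏ d ∈ Finset.range n,
          (∑ k ∈ Finset.range (d + 1), x ^ k) ^ (a d) * (1 / (1 - x ^ (d + 1))) ^ (b d)) *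
            (∑ k ∈ Finset.range (n + 1), x ^ k) ^ i * (1 / (1 - x ^ (n + 1))) ^ j) x := by
    intro i j x hx
    have h := (cyclo_kit (n + 1) (Function.update a n i) (Function.update b n j)).2.1 x hx
    simp only
    rw [cycloEdge_update n a b i j x]
    exact h
  -- existence of the intermediate monomials
  have hex : ∀ (i j : ℕ), ∃ R : IntegralRep 2,
      R.domain = KZlog.band {y : Fin 1 → ℝ | 0 < y 0 ∧ y 0 < 1} (fun _ => (1:ℝ))
        (fun y => (∏ d ∈ Finset.range n,
          (∑ k ∈ Finset.range (d + 1), y 0 ^ k) ^ (a d) * (1 / (1 - y 0 ^ (d + 1))) ^ (b d)) *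
            (∑ k ∈ Finset.range (n + 1), y 0 ^ k) ^ i * (1 / (1 - y 0 ^ (n + 1))) ^ j) ∧
      R.integrand = fun z => ((c : ℝ) / z 0) / z 1 := by
    intro i j
    have hint := (cyclo_kit (n + 1) (Function.update a n i) (Function.update b n j)).2.2 c
    have hint' : IntegrableOn (fun x : ℝ => (fun x : ℝ => (c : ℝ) / x) x * Real.log ((fun x : ℝ =>
        (∏ d ∈ Finset.range n,
          (∑ k ∈ Finset.range (d + 1), x ^ k) ^ (a d) * (1 / (1 - x ^ (d + 1))) ^ (b d)) *
            (∑ k ∈ Finset.range (n + 1), x ^ k) ^ i * (1 / (1 - x ^ (n + 1))) ^ j) x))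
        (Set.Ioo (0:ℝ) 1) := by
      refine hint.congr_fun (fun x _ => ?_) measurableSet_Ioo
      simp only
      rw [cycloEdge_update n a b i j x]
    exact exists_logMonomialRep _ _ (isSemialgebraicFunOn_ratCast_div c) (hsa i j) (h1 i j) hint'
  -- existence of the two one-factor monomials
  obtain ⟨Hd, hHdd, hHdi⟩ : ∃ Hd : IntegralRep 2,
      Hd.domain = KZlog.band {y : Fin 1 → ℝ | 0 < y 0 ∧ y 0 < 1} (fun _ => (1:ℝ))
        (fun y => 1 / (1 - y 0 ^ (n + 1))) ∧ Hd.integrand = fun z => ((c : ℝ) / z 0) / z 1 := by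
    obtain ⟨R, hRd, hRi⟩ := exists_cycloMonomialRep c (n + 1) (fun _ => 0) (Function.update (fun _ => 0) n 1)
    refine ⟨R, hRd.trans (KZlog.band_congr fun y _ => ?_), hRi⟩
    rw [Finset.prod_range_succ, Function.update_self]
    rw [Finset.prod_eq_one fun d hd => ?_]
    · simp
    · have hdn : d ≠ n := (Finset.mem_range.1 hd).ne
      rw [Function.update_of_ne hdn]
      simp
  obtain ⟨Gd, hGdd, hGdi⟩ : ∃ Gd : IntegralRep 2,
      Gd.domain = KZlog.band {y : Fin 1 → ℝ | 0 < y 0 ∧ y 0 < 1} (fun _ => (1:ℝ))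
        (fun y => ∑ k ∈ Finset.range (n + 1), y 0 ^ k) ∧ Gd.integrand = fun z => ((c : ℝ) / z 0) / z 1 := by
    obtain ⟨R, hRd, hRi⟩ := exists_cycloMonomialRep c (n + 1) (Function.update (fun _ => 0) n 1) (fun _ => 0)
    refine ⟨R, hRd.trans (KZlog.band_congr fun y _ => ?_), hRi⟩
    rw [Finset.prod_range_succ, Function.update_self]
    rw [Finset.prod_eq_one fun d hd => ?_]
    · simp
    · have hdn : d ≠ n := (Finset.mem_range.1 hd).ne
      rw [Function.update_of_ne hdn]
      simp
  obtain ⟨hbaseH, hbaseG⟩ := cyclo_base c n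
  -- the double induction
  intro i
  induction i with
  | zero =>
    intro j
    induction j with
    | zero =>
      intro R B hRd hRi hBd hBi
      refine IH R B (hRd.trans (KZlog.band_congr fun y _ => by simp)) hRi hBd fun x hx => ?_
      rw [hBi hx]
      push_cast
      ring
    | succ j ihj =>
      intro R B hRd hRi hBd hBi
      obtain ⟨R₁, hR₁d, hR₁i⟩ := hex 0 j
      obtain ⟨hpeelH, -⟩ := cyclo_peel c n _ (hsa 0 j) (h1 0 j)
      have e1 : of R - of R₁ - of Hd ∈ relations := by
        refine hpeelH R R₁ Hd (hRd.trans (KZlog.band_congr fun y _ => ?_)) hRi hR₁d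
          (hR₁i ▸ fun _ _ => rfl) hHdd (hHdi ▸ fun _ _ => rfl)
        simp only [pow_succ]
        ring
      obtain ⟨B₁, hB₁d, hB₁i⟩ := exists_zetaTwoRep (c * (ρ + (0:ℕ) * (1 - 1 / (n + 1)) + j / (n + 1)))
      obtain ⟨B₂, hB₂d, hB₂i⟩ := exists_zetaTwoRep (c / (n + 1))
      have e2 : of R₁ - of B₁ ∈ relations := ihj R₁ B₁ hR₁d (hR₁i ▸ fun _ _ => rfl) hB₁d hB₁i
      have e3 : of Hd - of B₂ ∈ relations := hbaseH Hd B₂ hHdd (hHdi ▸ fun _ _ => rfl) hB₂d hB₂i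
      have e4 : of B - of B₁ - of B₂ ∈ relations := by
        refine zetaTwoRep_add_mem_relations B B₁ B₂ hBd (fun x hx => ?_) hB₁d hB₁i hB₂d hB₂i
        rw [hBi hx]
        push_cast
        ring
      have e : of R - of B = (of R - of R₁ - of Hd) + (of R₁ - of B₁) + (of Hd - of B₂)
          - (of B - of B₁ - of B₂) := by abel
      rw [e]
      exact relations.sub_mem (relations.add_mem (relations.add_mem e1 e2) e3) e4
  | succ i ihi =>
    intro j R B hRd hRi hBd hBi
    obtain ⟨R₁, hR₁d, hR₁i⟩ := hex i j
    obtain ⟨-, hpeelG⟩ := cyclo_peel c n _ (hsa i j) (h1 i j)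
    have e1 : of R - of R₁ - of Gd ∈ relations := by
      refine hpeelG R R₁ Gd (hRd.trans (KZlog.band_congr fun y _ => ?_)) hRi hR₁d
        (hR₁i ▸ fun _ _ => rfl) hGdd (hGdi ▸ fun _ _ => rfl)
      simp only [pow_succ]
      ring
    obtain ⟨B₁, hB₁d, hB₁i⟩ := exists_zetaTwoRep (c * (ρ + i * (1 - 1 / (n + 1)) + j / (n + 1)))
    obtain ⟨B₂, hB₂d, hB₂i⟩ := exists_zetaTwoRep (c - c / (n + 1))
    have e2 : of R₁ - of B₁ ∈ relations := ihi j R₁ B₁ hR₁d (hR₁i ▸ fun _ _ => rfl) hB₁d hB₁i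
    have e3 : of Gd - of B₂ ∈ relations := hbaseG Gd B₂ hGdd (hGdi ▸ fun _ _ => rfl) hB₂d hB₂i
    have e4 : of B - of B₁ - of B₂ ∈ relations := by
      refine zetaTwoRep_add_mem_relations B B₁ B₂ hBd (fun x hx => ?_) hB₁d hB₁i hB₂d hB₂i
      rw [hBi hx]
      push_cast
      ring
    have e : of R - of B = (of R - of R₁ - of Gd) + (of R₁ - of B₁) + (of Gd - of B₂)
        - (of B - of B₁ - of B₂) := by abel
    rw [e]
    exact relations.sub_mem (relations.add_mem (relations.add_mem e1 e2) e3) e4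

/-- **Reduction of the pure-product cyclotomic log monomials** to level-one boxes (rules 1a, 1b, 2):
`M(c/x, F(n,a,b)) ≡ [(0,1)², c·ρ(n,a,b)/(1 − xy)]` with
`ρ(n,a,b) = Σ_{d<n} (a d·(1 − 1/(d+1)) + b d/(d+1)) ∈ ℚ` (so the value is `c·ρ·ζ(2)`).
[cite: KontsevichZagier2001, §1.2] -/
theorem cycloMonomial_prod_reduce (c : ℚ) : ∀ (n : ℕ) (a b : ℕ → ℕ) (R B : IntegralRep 2),
    R.domain = KZlog.band {y : Fin 1 → ℝ | 0 < y 0 ∧ y 0 < 1} (fun _ => (1:ℝ))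
      (fun y => ∏ d ∈ Finset.range n,
        (∑ i ∈ Finset.range (d + 1), y 0 ^ i) ^ (a d) * (1 / (1 - y 0 ^ (d + 1))) ^ (b d)) →
    EqOn R.integrand (fun z => ((c : ℝ) / z 0) / z 1) R.domain →
    B.domain = {x | ∀ i, x i ∈ Set.Ioo (0:ℝ) 1} →
    EqOn B.integrand (fun x => ((c * ∑ d ∈ Finset.range n,
      ((a d : ℚ) * (1 - 1 / (d + 1)) + (b d : ℚ) / (d + 1)) : ℚ) : ℝ) / (1 - x 0 * x 1)) B.domain →
    of R - of B ∈ relations := by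
  intro n
  induction n with
  | zero =>
    intro a b R B hRd hRi hBd hBi
    -- the band is a null set (fibres `{1}`), the box has integrand `0`
    have hR : of R ∈ relations := by
      refine of_mem_relations_of_volume_eq_zero R (measure_mono_null (fun z hz => ?_)
        (Measure.pi_hyperplane (fun _ => (volume : Measure ℝ)) 1 1))
      rw [hRd] at hz
      have h2 := hz.2
      simp only [Finset.range_zero, Finset.prod_empty] at h2
      show z 1 = 1
      exact le_antisymm h2.2 h2.1
    have hB : of B ∈ relations := of_mem_relations_of_eqOn_zero B fun x hx => by
      rw [hBi hx]
      simp
    exact relations.sub_mem hR hB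
  | succ n ih =>
    intro a b R B hRd hRi hBd hBi
    have h := cycloMonomial_peel_reduce c
      (∑ d ∈ Finset.range n, ((a d : ℚ) * (1 - 1 / (d + 1)) + (b d : ℚ) / (d + 1))) n a b
      (ih a b) (a n) (b n) R B (hRd.trans (KZlog.band_congr fun y _ => by
        rw [Finset.prod_range_succ]; ring)) hRi hBd (fun x hx => by
        rw [hBi hx]; simp only [Finset.sum_range_succ, add_assoc])
    exact h

/-- **Reduction of the general cyclotomic log monomial** `M(c/x, F/F')` (`F' ≤ F` on `(0,1)`) to the
level-one box `[(0,1)², c(ρ − ρ')/(1 − xy)]` (product rule: `F'·(F/F') = F`).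
[cite: KontsevichZagier2001, §1.2] -/
theorem cycloMonomial_reduce (c : ℚ) (n : ℕ) (a b a' b' : ℕ → ℕ)
    (hle : ∀ x ∈ Set.Ioo (0:ℝ) 1,
      ∏ d ∈ Finset.range n, (∑ i ∈ Finset.range (d + 1), x ^ i) ^ (a' d) * (1 / (1 - x ^ (d + 1))) ^ (b' d) ≤
      ∏ d ∈ Finset.range n, (∑ i ∈ Finset.range (d + 1), x ^ i) ^ (a d) * (1 / (1 - x ^ (d + 1))) ^ (b d))
    (R B : IntegralRep 2)
    (hRd : R.domain = KZlog.band {y : Fin 1 → ℝ | 0 < y 0 ∧ y 0 < 1} (fun _ => (1:ℝ))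
      (fun y => (∏ d ∈ Finset.range n,
        (∑ i ∈ Finset.range (d + 1), y 0 ^ i) ^ (a d) * (1 / (1 - y 0 ^ (d + 1))) ^ (b d)) /
        (∏ d ∈ Finset.range n,
        (∑ i ∈ Finset.range (d + 1), y 0 ^ i) ^ (a' d) * (1 / (1 - y 0 ^ (d + 1))) ^ (b' d))))
    (hRi : EqOn R.integrand (fun z => ((c : ℝ) / z 0) / z 1) R.domain)
    (hBd : B.domain = {x | ∀ i, x i ∈ Set.Ioo (0:ℝ) 1})
    (hBi : EqOn B.integrand (fun x => ((c * (∑ d ∈ Finset.range n,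
      ((a d : ℚ) * (1 - 1 / (d + 1)) + (b d : ℚ) / (d + 1)) - ∑ d ∈ Finset.range n,
      ((a' d : ℚ) * (1 - 1 / (d + 1)) + (b' d : ℚ) / (d + 1))) : ℚ) : ℝ) / (1 - x 0 * x 1)) B.domain) :
    of R - of B ∈ relations := by
  have hG := isSemialgebraic_unitInterval_fin_one
  obtain ⟨hsa, h1, -⟩ := cyclo_kit n a b
  obtain ⟨hsa', h1', -⟩ := cyclo_kit n a' b'
  obtain ⟨RF, hRFd, hRFi⟩ := exists_cycloMonomialRep c n a b
  obtain ⟨RF', hRF'd, hRF'i⟩ := exists_cycloMonomialRep c n a' b'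
  -- product rule `F'·(F/F') = F`
  have hpos' : ∀ y ∈ {y : Fin 1 → ℝ | 0 < y 0 ∧ y 0 < 1},
      (0:ℝ) < ∏ d ∈ Finset.range n,
        (∑ i ∈ Finset.range (d + 1), y 0 ^ i) ^ (a' d) * (1 / (1 - y 0 ^ (d + 1))) ^ (b' d) :=
    fun y hy => zero_lt_one.trans_le (h1' (y 0) ⟨hy.1, hy.2⟩)
  have hw : IsSemialgebraicFunOn ℚ {y : Fin 1 → ℝ | 0 < y 0 ∧ y 0 < 1}
      (fun y => (∏ d ∈ Finset.range n,
        (∑ i ∈ Finset.range (d + 1), y 0 ^ i) ^ (a d) * (1 / (1 - y 0 ^ (d + 1))) ^ (b d)) /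
        (∏ d ∈ Finset.range n,
        (∑ i ∈ Finset.range (d + 1), y 0 ^ i) ^ (a' d) * (1 / (1 - y 0 ^ (d + 1))) ^ (b' d))) :=
    IsSemialgebraicFunOn.div hsa hsa' fun y hy => (hpos' y hy).ne'
  have emul : of RF - of RF' - of R ∈ relations := by
    refine of_sub_of_sub_mem_relations_mul (m := 1) (g := fun y => (c : ℝ) / y 0) hG hsa' hw
      (fun y hy => h1' (y 0) ⟨hy.1, hy.2⟩)
      (fun y hy => ?_) RF RF' R (hRFd.trans (KZlog.band_congr fun y hy => ?_))
      (hRFi ▸ fun _ _ => rfl) hRF'd (hRF'i ▸ fun _ _ => rfl) hRd hRi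
    · exact (one_le_div (hpos' y hy)).2 (hle (y 0) ⟨hy.1, hy.2⟩)
    · simp only
      rw [mul_div_cancel₀ _ (hpos' y hy).ne']
  obtain ⟨B₁, hB₁d, hB₁i⟩ := exists_zetaTwoRep (c * ∑ d ∈ Finset.range n,
      ((a d : ℚ) * (1 - 1 / (d + 1)) + (b d : ℚ) / (d + 1)))
  obtain ⟨B₂, hB₂d, hB₂i⟩ := exists_zetaTwoRep (c * ∑ d ∈ Finset.range n,
      ((a' d : ℚ) * (1 - 1 / (d + 1)) + (b' d : ℚ) / (d + 1)))
  have e1 := cycloMonomial_prod_reduce c n a b RF B₁ hRFd (hRFi ▸ fun _ _ => rfl) hB₁d hB₁i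
  have e2 := cycloMonomial_prod_reduce c n a' b' RF' B₂ hRF'd (hRF'i ▸ fun _ _ => rfl) hB₂d hB₂i
  have e3 : of B₁ - of B₂ - of B ∈ relations := by
    refine zetaTwoRep_add_mem_relations B₁ B₂ B hB₁d (fun x hx => ?_) hB₂d hB₂i hBd hBi
    rw [hB₁i hx]
    push_cast
    ring
  have e : of R - of B = -(of RF - of RF' - of R) + (of RF - of B₁) - (of RF' - of B₂)
      + (of B₁ - of B₂ - of B) := by abel
  rw [e]
  exact relations.add_mem (relations.sub_mem (relations.add_mem (relations.neg_mem emul) e1) e2) e3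

end Summit.KontsevichZagierPeriods.HurwitzMicroSectors.NormalFormPrinciple.PiBox.M2
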